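import Literature.AlgebraicGeometry.Resolution.ResolutionOfSingularities
import Mathlib.FieldTheory.IsAlgClosed.Basic
import Mathlib.FieldTheory.Perfect
import Mathlib.RingTheory.AlgebraicIndependent.Basic
import Mathlib.Algebra.Field.Subfield.Basic
import Mathlib.Algebra.CharP.Algebra
import HarnessLib

/-!
# [OURS · L1 W8.2] SPECIALIZATION and the NORMAL FORMS of the prime-model transfer — door 2
# (`UniformComplexity` / `PrimeModelTransfer`) of slot W8.2; campaign statements, Theses-free module

Cell `res-hironaka` (run/shared/lean/pub/res-hironaka/), LADDER-RESOLUTION rung L (RESCUE), slot W8.2 of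
plan/RESCUE-SEED.md («PRIME-FIELD / UNIVERSALITY TRANSFER instead of descent»). SECOND DOOR: route
`UniformComplexity`, item `PrimeModelTransfer` (stmt-ResolutionOfSingularities-8933: for a prime `p`, resolution
of integral separated finite-type schemes over the algebraically closed fields ALGEBRAIC over `𝔽_p` ⇒ the same over
EVERY algebraically closed field of characteristic `p`). Statement-only file (typer res-L1-type-o6, statement-only
lane; two-lane rule: the slot's prover res-L1-s82-pv-2 proves AGAINST these names in its own Theorems files —
STATUS 2026-08-27T00:39:43Z «the DOWNWARD prime-model transfer as a THEOREM — SPECIALIZATION … and its door-2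
NORMAL FORMS by name»): eleven OURS `Prop`s and eight anchors (pure logic, plus one Mathlib lemma where flagged);
NOTHING is proved about resolution of singularities here and nothing is asserted.

WHY THIS FILE. Door 2 is reduced, sorry-free, to the shared climb kernel at algebraically closed constant fields
(p470934 / p475047 and res-L1-s82-pv-2's closers p470915 / p475050 / p475657 / p476882): that is the UPWARD
direction (from `𝔽̄_p` up a tower of algebraically closed subfields, p470438). The prover's second-generation
target is the DOWNWARD direction — SPECIALIZATION: `K ⊆ L`, `K` algebraically closed, `L` perfect, resolution
over `L` ⇒ resolution over `K` (intended proof in the docstring of `Specialization`) — and, with it, the NORMAL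
FORMS of the crux's `p`-slice `PrimeModelTransferAt p`, each an OURS `Prop` named below so that the prover's
equivalences are stated BY NAME:

* LEVELS `ResAlgClosedTrdegLe p d` («`R_d`»: resolution over every algebraically closed field of characteristic
  `p` of transcendence degree `≤ d` over its prime field; by Steinitz' theorem — Mathlib
  `IsAlgClosed.equivOfTranscendenceBasis` — and specialization, `R_d` is resolution over the ONE field
  `(𝔽_p(t₁,…,t_d))^{alg}`), and the LEVEL CLIMB `LevelClimb p` («`R_d ⇒ R_{d+1}` for every `d`»);
* the ONE-TRANSCENDENTAL CLIMB BETWEEN ALGEBRAICALLY CLOSED FIELDS `ClimbAlgClosed p` (no perfect closures: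
  `M` algebraically closed with resolution ⇒ resolution over every algebraically closed `K ⊇ M` of transcendence
  degree `≤ 1` over `M`);
* the SATURATED-MODEL FORM `OmegaTransferAt p Ω` / `OmegaTransfer p` (resolution over `𝔽̄_p` ⇒ resolution over
  ONE algebraically closed `Ω` of characteristic `p` of INFINITE transcendence degree).

Intended theorems of the prover (NOT proved here; details in the per-decl docstrings): `Specialization p`
outright; `PrimeModelTransferAt p ↔ LevelClimb p ↔ ClimbAlgClosed p`; for every algebraically closed `Ω` of
characteristic `p` with `ℵ₀ ≤ trdeg Ω`, `PrimeModelTransferAt p ↔ OmegaTransferAt p Ω`. `Specialization p` enters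
in `OmegaTransferAt p Ω → PrimeModelTransferAt p`, in `PrimeModelTransferAt p → ClimbAlgClosed p` and in reading
the level `R_d` as resolution over the one field `(𝔽_p(t₁,…,t_d))^{alg}`; the other directions use the tower and
descent of p470438, an algebraicity lemma and pure logic. The anchors below give the pure-logic directions only.

BUILD RULE (cell, director-resolution 2026-08-26T18:53:29Z (B)): OURS vocabulary file, THESES-FREE BY BIRTH —
imports only `Literature.AlgebraicGeometry.Resolution.ResolutionOfSingularities` (for `Scheme.HasResolution`),
Mathlib and `HarnessLib`. The by-name identification `Theses.UniformComplexity.PrimeModelTransfer ↔ ∀ p, p.Prime →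
PrimeModelTransferAt p` is `Iff.rfl` and belongs in a Theses-importing leaf (Links) file, not here.

HONEST FRAMING. The `def`s below are OURS — campaign statements that REPLACE THE ROLE of a printed item of
H. Hironaka's manuscript *Resolution of singularities in positive characteristics* (2017-03-23, [Hironaka2017],
lit key `paper:url-3343fd9e678b`; PDF page = printed page, `l.` = line of the page text file) — namely §17 ¶2,
p.89 l.59–62: «In this work the base field K is always assumed to be a finite field or Z/pZ because our
resolution is for all dimension. When the K has transcendence degree d we can reformulate the resolution problem
to the case of dimension d + dim Z.» (typed AS PRINTED, not asserted, as `S17Methodology.U89_2` / `U89_3` /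
`U89_3_ours`, Literature/AlgebraicGeometry/Hironaka2017/S17Methodology/R100Methodology.lean, p455149). The printed
sentence claims SUFFICIENCY of the prime field; the normal forms below say, in the summit's non-embedded idiom and
for ALGEBRAICALLY CLOSED fields only (door 2's universe), what that sufficiency is EQUIVALENT to, and
`Specialization` is the (unprinted, folklore) NECESSITY direction. Hironaka's statements are CANDIDATES under
adjudication (D-0012/D-0089); nothing here is attributed to the author and no verdict on the manuscript is
implied. AI typing, weaker than expert review.

CONTEXT (labelled context, not a premise): the route's item text for stmt-8933 records the model-theoretic reading
(«informally equivalent, via ACF_p-completeness and compactness, to a uniform bound on resolution complexity over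
F_p-bar»; sources listed there). None of it is formalised or used; the `Prop`s below are scheme-theoretic.

CONTENTS (namespace `…Theorems.CampaignW82`, all `Prop`s closed unless parameters are shown):
* `PrimeClosureRes p` — the crux HYPOTHESIS `p`-slice verbatim («`R_0` in the crux's idiom»: resolution over
  every algebraically closed `k` of characteristic `p` in which every element satisfies `x ^ p ^ n = x` for some
  `n ≥ 1`);
* `AlgClosedRes p` — the crux CONCLUSION `p`-slice verbatim (resolution over every algebraically closed field of
  characteristic `p`);
* `PrimeModelTransferAt p := PrimeClosureRes p → AlgClosedRes p` — the crux's `p`-slice (definitionally);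
* `Specialization p`, `SpecializationDimLe p n` — THEOREM grade (the prover's target), ungraded / graded;
* `ResAlgClosedTrdegLe p d` (cumulative level «`R_d`», transcendence degree `≤ d`), `ResAlgClosedTrdegEq p d`
  (exact level «`R_d^=`», `= d`: the prover's «`Res((𝔽_p(t₁…t_d))^alg)`» without a chosen model), `LevelClimb p`,
  `ClimbAlgClosed p`, `OmegaTransferAt p Ω`, `OmegaTransfer p` — the normal forms (open-problem grade, like the
  crux);
* anchors: `specialization_iff_top`, `resAlgClosedTrdegLe_anti`, `resAlgClosedTrdegEq_of_resAlgClosedTrdegLe`,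
  `resAlgClosedTrdegLe_of_algClosedRes`, `forall_resAlgClosedTrdegLe_of_zero_of_levelClimb`,
  `climbAlgClosed_of_algClosedRes`, `omegaTransferAt_of_primeModelTransferAt`,
  `omegaTransfer_of_primeModelTransferAt`.

BARRIERS (`Literature/Barriers/ResolutionOfSingularities/`; read, not used): `Specialization` base-changes only
SMOOTH models over a PERFECT `L` down to an algebraically closed `K` — no inseparable extension of an imperfect field
occurs, so the transport barriers (`RegularNotGeometricallyRegular.lean`; `InseparableBaseChangeResolution.lean`:
`not_hasResolution_pullback_extField`, `not_isRegular_stable_groundFieldExtension`; `FrobeniusTwistResolution.lean`: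
`not_hasResolution_Spec_frobTwist`) are not met. The normal forms evade nothing: each is equivalent (prover's
intended theorems) to the crux's `p`-slice, whose honest residual is the perfection step over the imperfect
fields `M(t)` (p470934 / p475047), exactly where those barriers bite.

VACUITY SELF-CHECK (one line per decl in the docstrings): for prime `p` no `Prop` below is trivially false (each
instance follows from the summit conjunct `ResolutionInChar p`); none is trivially true except `SpecializationDimLe
p ⊥` (integral schemes are nonempty) — `Specialization` has the idle instance `L = K` but quantifies over all `L`;
`ResAlgClosedTrdegLe p d` at every `d ≥ 0` contains resolution over `𝔽̄_p` in all dimensions (open for dimension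
`≥ 4`). Composite `p > 1`: every `Prop` is vacuous (no field of that characteristic); `p = 0`: not intended
(characteristic-zero fields; every W8.2 consumer instantiates at a prime).

## References (vocabulary and locators only; nothing cited as a premise)
* H. Hironaka, ms. 2017-03-23, §17 ¶2 p.89 l.59–62 — under adjudication, quoted for the role replaced, not
  asserted. [Hironaka2017]
* E. Steinitz (1910), via Mathlib `IsAlgClosed.equivOfTranscendenceBasis` — docstring vocabulary only. [folklore]
* Theses/UniformComplexity.lean item stmt-8933; L/res-L1-s82-pv-2/DOOR2-KERNEL.md §3(c), §4.4;
  L/res-L1-type-o6/W82-TYPED-MAP.md — cell files, OURS.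
-/

noncomputable section

set_option linter.dupNamespace false -- mandated namespace of this single-conjunct summit

open _root_.CategoryTheory _root_.AlgebraicGeometry
open Literature.AlgebraicGeometry.Resolution

namespace Summit.ResolutionOfSingularities.ResolutionOfSingularities.Theorems.CampaignW82

/-! ## The crux's `p`-slice, split into its two blocks (verbatim) -/

/-- [OURS · L1 W8.2 door 2] replaces the role of §17 ¶2, p.89 l.59–60 («the base field K is always assumed to be
a finite field or Z/pZ»; typed as `S17Methodology.U89_2`) as the HYPOTHESIS block of the crux `PrimeModelTransfer`
(stmt-ResolutionOfSingularities-8933) at one prime `p`, VERBATIM; NOT a statement of the manuscript.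
RESOLUTION OVER THE PRIME MODEL («`R_0`» in the crux's idiom): every integral separated scheme of finite type over
every ALGEBRAICALLY CLOSED field `k` of characteristic `p` that is algebraic over `𝔽_p` — elementwise: every
`x : k` satisfies `x ^ p ^ n = x` for some `n ≥ 1`, i.e. `k ≅ 𝔽̄_p` — has a resolution (`Scheme.HasResolution`).
The `p`-slice of `Theses.UniformComplexity.PrimeClosureThesis` (crux stmt-ResolutionOfSingularities-14688, «the
prime model of ACF_p») binder for binder. Relation to the level `ResAlgClosedTrdegLe p 0` (transcendence degree
`≤ 0` over the prime subfield instead of the elementwise clause): equivalent, by Mathlib `trdeg_eq_zero_iff`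
(`Algebra.trdeg R A = 0 ↔ Algebra.IsAlgebraic R A`) and res-L1-s82-pv-2's
`Theorems.PrimeModelTransfer.pow_prime_pow_eq_self_of_isAlgebraic` (p470438) — the prover's lemma, not an anchor
here. Vacuity (prime `p`): an open statement (resolution over `𝔽̄_p` in every dimension; dimension `≤ 3` is the
named fact F-02), neither trivially true nor trivially false; composite `p > 1` vacuous. [folklore] -/
def PrimeClosureRes (p : ℕ) : Prop :=
  ∀ (k : Type) [Field k] [CharP k p] [IsAlgClosed k], (∀ x : k, ∃ n : ℕ, 0 < n ∧ x ^ p ^ n = x) →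
    ∀ (X : Scheme.{0}) (f : X ⟶ Spec (.of k)),
      IsSeparated f → LocallyOfFiniteType f → QuasiCompact f → IsIntegral X → Scheme.HasResolution X

/-- [OURS · L1 W8.2 door 2] replaces the role of §17 ¶2, p.89 l.59–62 as the CONCLUSION block of the crux
`PrimeModelTransfer` (stmt-ResolutionOfSingularities-8933) at one prime `p`, VERBATIM; NOT a statement of the
manuscript. RESOLUTION OVER ALL ALGEBRAICALLY CLOSED FIELDS OF CHARACTERISTIC `p`: every integral separated scheme
of finite type over every algebraically closed field `K` with `CharP K p` has a resolution. Door 2's universe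
(algebraically closed ground fields) of the summit conjunct `ResolutionInChar p` (all fields, reduced schemes;
the reduction reduced ⇒ integral at a fixed field is the tree's `DescentReducedToIntegral_holds`). Vacuity (prime
`p`): open (contains `PrimeClosureRes p`); neither trivially true nor trivially false; composite `p > 1` vacuous.
[folklore] -/
def AlgClosedRes (p : ℕ) : Prop :=
  ∀ (K : Type) [Field K] [CharP K p] [IsAlgClosed K] (X : Scheme.{0}) (f : X ⟶ Spec (.of K)),
    IsSeparated f → LocallyOfFiniteType f → QuasiCompact f → IsIntegral X → Scheme.HasResolution X

/-- [OURS · L1 W8.2 door 2] replaces the role of §17 ¶2, p.89 l.59–62 («a finite field or Z/pZ because our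
resolution is for all dimension»; `S17Methodology.U89_2` / `U89_3`) for ALGEBRAICALLY CLOSED target fields, as the
`p`-SLICE of the crux `Theses.UniformComplexity.PrimeModelTransfer` (stmt-ResolutionOfSingularities-8933); NOT a
statement of the manuscript. THE PRIME-MODEL TRANSFER AT `p`: `PrimeClosureRes p → AlgClosedRes p` — resolution
over `𝔽̄_p` implies resolution over every algebraically closed field of characteristic `p`. By construction
`Theses.UniformComplexity.PrimeModelTransfer ↔ ∀ p, p.Prime → PrimeModelTransferAt p` holds by `Iff.rfl` (to be
stated in a Theses-importing Links file; this module is Theses-free). Its reductions of record: ⇐ the climb kernel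
at algebraically closed constant fields (`ClimbRatFuncPerfAlgClosed p`, p470934; closer p470915), ⇐ the
perfection step `PerfectionStepAlgClosureFgDimLe p ⊤` (p475047; closer p476882). Its NORMAL FORMS (this file):
`LevelClimb p`, `ClimbAlgClosed p`, `OmegaTransferAt p Ω` — equivalences to be proved by res-L1-s82-pv-2 (the
last two via `Specialization p`). Open-problem grade (route text: «difficulty: open-problem»). Vacuity (prime `p`): not
trivially true (the hypothesis `PrimeClosureRes p` is itself open, so the implication is not settled by a false
antecedent either way on current knowledge; dimension `≤ 3` instances of both blocks are theorems ⇐ F-02);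
never trivially false (follows from `ResolutionInChar p`); composite `p > 1` vacuous. [folklore] -/
def PrimeModelTransferAt (p : ℕ) : Prop :=
  PrimeClosureRes p → AlgClosedRes p

/-! ## Specialization (the downward transfer) — THEOREM grade, the prover's target -/

/-- [OURS · L1 W8.2 door 2] companion to the role of §17 ¶2, p.89 l.59–62 (the manuscript's «we may choose
K = Z/pZ», §2 p.4 l.24, asserts SUFFICIENCY of the prime field; this is the unprinted NECESSITY direction, used
to put the transfer in normal form); NOT a statement of the manuscript. SPECIALIZATION at `p` (ungraded): for
every ALGEBRAICALLY CLOSED field `K` of characteristic `p` and every PERFECT field `L` that is a `K`-algebra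
(`[Algebra K L]`, i.e. a field extension `K ⊆ L`; algebraically closed `L` is the instance
`IsAlgClosed.perfectField`), if every integral separated `L`-scheme of finite type has a resolution then so does
every integral separated `K`-scheme of finite type. Intended proof (res-L1-s82-pv-2, STATUS 2026-08-27T00:39:43Z;
folklore, EGA IV₃ 8.10.5 / IV₄ 17.7.8 style, not in print in this form): given `X / K`, resolve
`X_L := X ×_K Spec L` by `X' → X_L` (`X'` regular, hence SMOOTH over the perfect `L` —
`Literature.AlgebraicGeometry.Resolution.smooth_of_isRegular_of_perfectField`, file
Resolution/SmoothOfRegularPerfectField.lean); spread `X' → X_L` out to `𝒳' → X ×_K Spec R` over a finitely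
generated `K`-subalgebra `R ⊆ L` (tree: Literature/AlgebraicGeometry/Limits/SubalgebraSpread.lean,
GenericSmoothnessSpread.lean, LocalizationProperSpread.lean, LocalizationIsoSpread.lean), shrink `Spec R` so
that `𝒳' → Spec R` is smooth and `𝒳' → X_R` is proper and an isomorphism over a dense open of every fibre; `R` has
a `K`-point
(`K` algebraically closed, Hilbert's Nullstellensatz); the fibre there is a proper birational `K`-morphism onto
`X` from a scheme smooth over `K`, hence regular — a resolution of `X` (integrality of the fibre: the clopen
component through the generic point, or geometric irreducibility of the smooth generic fibre). Why `K`
algebraically closed: a merely perfect `K` need not have `K`-points on `Spec R`, and a closed point with residue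
field `K' ⊋ K` only yields resolution over `K'` (Galois descent `K' → K` is the crux `DescentAlgclosedToPerfect`,
stmt-0550). Why `L` perfect: over an imperfect `L` a resolution is regular but maybe not smooth, and regularity
does not spread/specialise (barrier `RegularNotGeometricallyRegular.lean`). Uses: `R_{d+1} ⇒ R_d`; resolution
over `Ω ⇒` resolution over every algebraically closed subfield of `Ω`; resolution over any algebraically closed
`M ⇒ PrimeClosureRes p` (take `K = 𝔽_p^{alg} ∩ M`). Graded form `SpecializationDimLe p n`; this is its grade `⊤`
(`specialization_iff_top`). Vacuity (prime `p`): the instance `L = K` is idle but the statement quantifies over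
ALL perfect `L ⊇ K` (e.g. `K = 𝔽̄_p ⊆ L = Ω`), so it is not trivially true; never trivially false (follows from
`ResolutionInChar p`); composite `p > 1` vacuous. [folklore] -/
def Specialization (p : ℕ) : Prop :=
  ∀ (K : Type) [Field K] [CharP K p] [IsAlgClosed K] (L : Type) [Field L] [PerfectField L] [Algebra K L],
    (∀ (X : Scheme.{0}) (f : X ⟶ Spec (.of L)),
        IsSeparated f → LocallyOfFiniteType f → QuasiCompact f → IsIntegral X → Scheme.HasResolution X) →
      ∀ (X : Scheme.{0}) (f : X ⟶ Spec (.of K)),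
        IsSeparated f → LocallyOfFiniteType f → QuasiCompact f → IsIntegral X → Scheme.HasResolution X

/-- [OURS · L1 W8.2 door 2] companion to the role of §17 ¶2, p.89 l.59–62, GRADED BY DIMENSION; NOT a statement of
the manuscript. SPECIALIZATION at `p`, grade `n`: as `Specialization p` with `topologicalKrullDim X ≤ n` on both
sides — resolution of integral separated finite-type `L`-schemes of dimension `≤ n` (`L` perfect) implies
resolution of integral separated finite-type `K`-schemes of dimension `≤ n` (`K ⊆ L` algebraically closed). The
same grade on both sides is the right bookkeeping: `dim (X ×_K Spec L) = dim X` for `X` of finite type over the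
field `K` (to be supplied by the prover; tree vocabulary `topologicalKrullDim`). THEOREM grade at every `n` by the
intended proof of `Specialization p`; NOT monotone in `n` (hypothesis and conclusion move together). Vacuity
(prime `p`): trivially true at `n = ⊥` only (integral schemes are nonempty); never trivially false; composite
`p > 1` vacuous. [folklore] -/
def SpecializationDimLe (p : ℕ) (n : WithBot ℕ∞) : Prop :=
  ∀ (K : Type) [Field K] [CharP K p] [IsAlgClosed K] (L : Type) [Field L] [PerfectField L] [Algebra K L],
    (∀ (X : Scheme.{0}) (f : X ⟶ Spec (.of L)),
        IsSeparated f → LocallyOfFiniteType f → QuasiCompact f → IsIntegral X →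
          topologicalKrullDim X ≤ n → Scheme.HasResolution X) →
      ∀ (X : Scheme.{0}) (f : X ⟶ Spec (.of K)),
        IsSeparated f → LocallyOfFiniteType f → QuasiCompact f → IsIntegral X →
          topologicalKrullDim X ≤ n → Scheme.HasResolution X

/-! ## The normal forms of `PrimeModelTransferAt p` (open-problem grade, like the crux) -/

/-- [OURS · L1 W8.2 door 2] replaces the role of §17 ¶2, p.89 l.60–62 («When the K has transcendence degree d we
can reformulate the resolution problem to the case of dimension d + dim Z»; `S17Methodology.U89_3`, whose idiom
`Algebra.trdeg (⊥ : Subfield K) K` for «transcendence degree over the prime field» is reused) for ALGEBRAICALLY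
CLOSED fields, LEVEL BY LEVEL; NOT a statement of the manuscript. RESOLUTION AT TRANSCENDENCE LEVEL `d` («`R_d`»):
every integral separated scheme of finite type over every algebraically closed field `K` of characteristic `p`
with `Algebra.trdeg (⊥ : Subfield K) K ≤ d` (transcendence degree over the prime subfield `⊥ ≅ 𝔽_p`) has a
resolution. By Steinitz' theorem (Mathlib `IsAlgClosed.equivOfTranscendenceBasis`: algebraically closed fields of
equal characteristic with equinumerous transcendence bases are isomorphic) and `Specialization p`, `R_d` is
resolution over the SINGLE field `(𝔽_p(t₁,…,t_d))^{alg}` — the prover's normal form «`R_d := Res((𝔽_p(t₁…t_d))^alg)`»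
(STATUS 2026-08-27T00:39:43Z); the isomorphism-invariance of the resolution block is the landed
`Theorems.PrimeModelTransfer.hasResolution_of_integralResOver_ringEquiv` (p470438). `R_0` is `PrimeClosureRes p`
up to the prover's algebraicity lemma (see there). Antitone in `d` (`resAlgClosedTrdegLe_anti`); every level
follows from `AlgClosedRes p` (`resAlgClosedTrdegLe_of_algClosedRes`). Vacuity (prime `p`): open at every `d`
(contains resolution over `𝔽̄_p` in all dimensions); never trivially false; composite `p > 1` vacuous.
[folklore] -/
def ResAlgClosedTrdegLe (p d : ℕ) : Prop :=
  ∀ (K : Type) [Field K] [CharP K p] [IsAlgClosed K], Algebra.trdeg (⊥ : Subfield K) K ≤ d →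
    ∀ (X : Scheme.{0}) (f : X ⟶ Spec (.of K)),
      IsSeparated f → LocallyOfFiniteType f → QuasiCompact f → IsIntegral X → Scheme.HasResolution X

/-- [OURS · L1 W8.2 door 2] replaces the role of §17 ¶2, p.89 l.60–62 («transcendence degree d») for
ALGEBRAICALLY CLOSED fields at ONE EXACT LEVEL; NOT a statement of the manuscript. RESOLUTION AT TRANSCENDENCE
DEGREE EXACTLY `d` («`R_d^=`»): every integral separated scheme of finite type over every algebraically closed
field `K` of characteristic `p` with `Algebra.trdeg (⊥ : Subfield K) K = d` has a resolution — by Steinitz all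
such `K` are isomorphic to `(𝔽_p(t₁,…,t_d))^{alg}`, so this IS the prover's «`R_d := Res((𝔽_p(t₁…t_d))^alg)`»
(STATUS 2026-08-27T00:39:43Z) stated without choosing a model. The cumulative level implies it
(`resAlgClosedTrdegEq_of_resAlgClosedTrdegLe`, pure logic); the converse `ResAlgClosedTrdegEq p d →
ResAlgClosedTrdegLe p d`, i.e. the prover's «`R_{d+1} ⇒ R_d`», is `Specialization p` at work (a field of
smaller transcendence degree embeds into one of degree `d`) — THEOREM grade, not proved here. Vacuity (prime
`p`): open at every `d`; never trivially false; such `K` exist for every `d` (not vacuous); composite `p > 1`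
vacuous. [folklore] -/
def ResAlgClosedTrdegEq (p d : ℕ) : Prop :=
  ∀ (K : Type) [Field K] [CharP K p] [IsAlgClosed K], Algebra.trdeg (⊥ : Subfield K) K = d →
    ∀ (X : Scheme.{0}) (f : X ⟶ Spec (.of K)),
      IsSeparated f → LocallyOfFiniteType f → QuasiCompact f → IsIntegral X → Scheme.HasResolution X

/-- [OURS · L1 W8.2 door 2] replaces the role of §17 ¶2, p.89 l.59–62 for ALGEBRAICALLY CLOSED fields as the
LEVEL-BY-LEVEL NORMAL FORM of the prime-model transfer; NOT a statement of the manuscript. THE LEVEL CLIMB at `p`: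
for every `d : ℕ`, resolution at transcendence level `d` implies resolution at level `d + 1` —
`ResAlgClosedTrdegLe p d → ResAlgClosedTrdegLe p (d + 1)` («`R_d ⇒ R_{d+1}`»). Intended theorem of
res-L1-s82-pv-2 (not proved here): `PrimeModelTransferAt p ↔ LevelClimb p` — «⇐»: with `R_0 ⇐ PrimeClosureRes p`
(the algebraicity lemma, see `PrimeClosureRes`) all finite levels follow
(`forall_resAlgClosedTrdegLe_of_zero_of_levelClimb`), and an arbitrary algebraically closed `K` is exhausted by
algebraically closed subfields of finite transcendence degree, each a level (the tower and the descent of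
p470438: `exists_isAlgClosed_subfield_hasResolution` pattern, `hasResolution_of_perfectSubfields`); «⇒»:
`R_d ⇒ R_0` (`resAlgClosedTrdegLe_anti`) `⇒ PrimeClosureRes p` (algebraicity lemma), then `AlgClosedRes p` gives
every level (`resAlgClosedTrdegLe_of_algClosedRes`) — no specialization needed for this normal form. One step
`R_d ⇒ R_{d+1}` is ONE instance of `ClimbAlgClosed p` (adjoin one transcendental to an algebraically closed field
of transcendence degree `d` and close algebraically) — the prover's lemma, it needs a transcendence basis, not
pure logic. Open-problem grade (equivalent to the crux's `p`-slice). Vacuity (prime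
`p`): not trivially true (no level is known beyond dimension `≤ 3`), never trivially false (follows from
`ResolutionInChar p`, which gives every level outright); composite `p > 1` vacuous. [folklore] -/
def LevelClimb (p : ℕ) : Prop :=
  ∀ d : ℕ, ResAlgClosedTrdegLe p d → ResAlgClosedTrdegLe p (d + 1)

/-- [OURS · L1 W8.2 door 2] replaces the role of §17 ¶2, p.89 l.59–62 one transcendental at a time BETWEEN
ALGEBRAICALLY CLOSED FIELDS — no perfect closures, no purely inseparable extensions in the statement; NOT a
statement of the manuscript. THE ALGEBRAICALLY CLOSED ONE-TRANSCENDENTAL CLIMB at `p`: for every algebraically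
closed field `M` of characteristic `p` over which every integral separated `M`-scheme of finite type has a
resolution, and every ALGEBRAICALLY CLOSED field `K` that is an `M`-algebra with `Algebra.trdeg M K ≤ 1` (so
`K = M` or `K ≅ (M(t))^{alg}`), every integral separated `K`-scheme of finite type has a resolution. Compare the
climb kernel `ClimbRatFuncPerfAlgClosed p` (p470934: target the PERFECT CLOSURE `M(t)^{perf}`, not algebraically
closed): `ClimbAlgClosed p ⇐ ClimbRatFuncPerfAlgClosed p` + the landed algebraic climb
(`Theorems.PrimeFieldToPerfect.stub_climbAlgebraic`, p154863), via res-L1-s82-pv-2's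
`Theorems.PrimeModelTransfer.hasResolution_algebraicClosure_adjoin_simple` (p470438: an algebraically closed `K`
of transcendence degree `1` over `M` is the algebraic closure of `M(t)` in `K` for any transcendental `t ∈ K`;
degree `0` gives `K = M`) — the prover's lemma, not an anchor here; the converse is not claimed. Intended theorem
(not proved here): `PrimeModelTransferAt p ↔ ClimbAlgClosed p` («⇐» by the tower of algebraically closed
subfields, p470438; «⇒» by `Specialization p`: `M ⊇ 𝔽_p^{alg} ∩ M` gives `PrimeClosureRes p`, then
`AlgClosedRes p`; `K` has the characteristic of `M` — `climbAlgClosed_of_algClosedRes`). Open-problem grade; its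
honest residual is the crux's (the perfection step over `M(t)`, p470934 / p475047). Vacuity (prime `p`): the
instance `K = M` (transcendence degree `0`) is idle but the statement quantifies over all `K` of transcendence
degree `≤ 1`; not trivially true, never trivially false; composite `p > 1` vacuous. [folklore] -/
def ClimbAlgClosed (p : ℕ) : Prop :=
  ∀ (M : Type) [Field M] [CharP M p] [IsAlgClosed M],
    (∀ (X : Scheme.{0}) (f : X ⟶ Spec (.of M)),
        IsSeparated f → LocallyOfFiniteType f → QuasiCompact f → IsIntegral X → Scheme.HasResolution X) →
      ∀ (K : Type) [Field K] [Algebra M K] [IsAlgClosed K], Algebra.trdeg M K ≤ 1 →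
        ∀ (X : Scheme.{0}) (f : X ⟶ Spec (.of K)),
          IsSeparated f → LocallyOfFiniteType f → QuasiCompact f → IsIntegral X → Scheme.HasResolution X

/-- [OURS · L1 W8.2 door 2] replaces the role of §17 ¶2, p.89 l.59–62 for ONE algebraically closed target field
(the «saturated model» normal form); NOT a statement of the manuscript. THE `Ω`-TRANSFER at `p`, for a GIVEN
algebraically closed field `Ω` of characteristic `p` (parameters `Ω`, `[Field Ω]`, `[CharP Ω p]`,
`[IsAlgClosed Ω]`): `PrimeClosureRes p →` every integral separated `Ω`-scheme of finite type has a resolution —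
the crux's `p`-slice with its conclusion instantiated at the single field `Ω` (`omegaTransferAt_of_primeModelTransferAt`,
pure logic). Intended theorem of res-L1-s82-pv-2 (not proved here): if `ℵ₀ ≤ Algebra.trdeg (⊥ : Subfield Ω) Ω`
(INFINITE transcendence degree over the prime subfield, e.g. `Ω = (𝔽_p(t₁, t₂, …))^{alg}`), then
`OmegaTransferAt p Ω → PrimeModelTransferAt p`: every algebraically closed field of characteristic `p` of finite
transcendence degree embeds into `Ω` (Steinitz), so inherits resolution by `Specialization p`, and an arbitrary
algebraically closed `K` is exhausted by such subfields (descent of p470438). Finite transcendence degree does NOT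
suffice for that argument (no embedding of higher levels), whence the hypothesis. Open-problem grade for every
`Ω` (contains resolution over `Ω` in all dimensions given it over `𝔽̄_p`). Vacuity (prime `p`): not trivially
true; never trivially false (follows from `ResolutionInChar p`); at `Ω` algebraic over `𝔽_p` it is the idle
instance «`R_0 ⇒ R_0`» up to the algebraicity lemma; composite `p > 1`: no such `Ω` exists, so every closed
instance is vacuous. [folklore] -/
def OmegaTransferAt (p : ℕ) (Ω : Type) [Field Ω] [CharP Ω p] [IsAlgClosed Ω] : Prop :=
  PrimeClosureRes p →
    ∀ (X : Scheme.{0}) (f : X ⟶ Spec (.of Ω)),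
      IsSeparated f → LocallyOfFiniteType f → QuasiCompact f → IsIntegral X → Scheme.HasResolution X

/-- [OURS · L1 W8.2 door 2] replaces the role of §17 ¶2, p.89 l.59–62 as the CLOSED saturated-model normal form;
NOT a statement of the manuscript. THE `Ω`-TRANSFER at `p`, universally over the admissible `Ω`: for every
algebraically closed field `Ω` of characteristic `p` of INFINITE transcendence degree over its prime subfield
(`Cardinal.aleph0 ≤ Algebra.trdeg (⊥ : Subfield Ω) Ω`), `OmegaTransferAt p Ω`. A CONSEQUENCE of the crux's
`p`-slice by pure logic (`omegaTransfer_of_primeModelTransferAt`); EQUIVALENT to it by the prover's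
intended theorem (one such `Ω` already suffices — that is the point of the normal form; the universal closure is
typed because a closed `Prop` must not depend on a chosen model of `Ω`). Open-problem grade. Vacuity (prime `p`): not
trivially true (such `Ω` exist, e.g. an algebraic closure of `𝔽_p(t₁, t₂, …)`), never trivially false; composite
`p > 1` vacuous. [folklore] -/
def OmegaTransfer (p : ℕ) : Prop :=
  ∀ (Ω : Type) [Field Ω] [CharP Ω p] [IsAlgClosed Ω],
    Cardinal.aleph0 ≤ Algebra.trdeg (⊥ : Subfield Ω) Ω → OmegaTransferAt p Ω

/-! ## Anchors (pure logic unless flagged) -/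

/-- **Ungraded specialization is the grade `⊤`** (pure logic, `le_top`). [folklore] -/
theorem specialization_iff_top (p : ℕ) : Specialization p ↔ SpecializationDimLe p ⊤ := by
  constructor
  · intro h K _ _ _ L _ _ _ hL X f hs hl hq hX _
    exact h K L (fun Y g hs' hl' hq' hY => hL Y g hs' hl' hq' hY le_top) X f hs hl hq hX
  · intro h K _ _ _ L _ _ _ hL X f hs hl hq hX
    exact h K L (fun Y g hs' hl' hq' hY _ => hL Y g hs' hl' hq' hY) X f hs hl hq hX le_top

/-- **The levels are antitone in `d`** (pure logic after `Nat.cast_le` in `Cardinal`): `d ≤ d' →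
ResAlgClosedTrdegLe p d' → ResAlgClosedTrdegLe p d`. [folklore] -/
theorem resAlgClosedTrdegLe_anti {p d d' : ℕ} (hdd' : d ≤ d') (h : ResAlgClosedTrdegLe p d') :
    ResAlgClosedTrdegLe p d :=
  fun K _ _ _ hd X f hs hl hq hX =>
    h K (hd.trans (by exact_mod_cast hdd')) X f hs hl hq hX

/-- **The cumulative level implies the exact level** (pure logic, `le_of_eq`): `ResAlgClosedTrdegLe p d →
ResAlgClosedTrdegEq p d`. (The converse is the prover's specialization step.) [folklore] -/
theorem resAlgClosedTrdegEq_of_resAlgClosedTrdegLe {p d : ℕ} (h : ResAlgClosedTrdegLe p d) :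
    ResAlgClosedTrdegEq p d :=
  fun K _ _ _ hd X f hs hl hq hX => h K hd.le X f hs hl hq hX

/-- **Every level follows from the crux conclusion** (pure logic): `AlgClosedRes p → ResAlgClosedTrdegLe p d`.
[folklore] -/
theorem resAlgClosedTrdegLe_of_algClosedRes {p : ℕ} (h : AlgClosedRes p) (d : ℕ) : ResAlgClosedTrdegLe p d :=
  fun K _ _ _ _ X f hs hl hq hX => h K X f hs hl hq hX

/-- **Level induction** (pure logic, `Nat.rec`): level `0` and the level climb give every level —
`ResAlgClosedTrdegLe p 0 → LevelClimb p → ∀ d, ResAlgClosedTrdegLe p d`. [folklore] -/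
theorem forall_resAlgClosedTrdegLe_of_zero_of_levelClimb {p : ℕ} (h0 : ResAlgClosedTrdegLe p 0)
    (h : LevelClimb p) : ∀ d : ℕ, ResAlgClosedTrdegLe p d
  | 0 => h0
  | d + 1 => h d (forall_resAlgClosedTrdegLe_of_zero_of_levelClimb h0 h d)

/-- **The algebraically closed climb is a weakening of the crux conclusion** (Mathlib
`charP_of_injective_algebraMap`: a field extension of a field of characteristic `p` has characteristic `p`;
otherwise pure logic): `AlgClosedRes p → ClimbAlgClosed p`. Hence `PrimeModelTransferAt p → PrimeClosureRes p →
ClimbAlgClosed p`. [folklore] -/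
theorem climbAlgClosed_of_algClosedRes {p : ℕ} (h : AlgClosedRes p) : ClimbAlgClosed p :=
  fun M _ _ _ _ K _ _ _ _ X f hs hl hq hX => by
    haveI : CharP K p := charP_of_injective_algebraMap (algebraMap M K).injective p
    exact h K X f hs hl hq hX

/-- **The `Ω`-transfer at any `Ω` follows from the crux's `p`-slice** (pure logic: instantiate the conclusion
at `Ω`). [folklore] -/
theorem omegaTransferAt_of_primeModelTransferAt {p : ℕ} (h : PrimeModelTransferAt p) (Ω : Type) [Field Ω]
    [CharP Ω p] [IsAlgClosed Ω] : OmegaTransferAt p Ω :=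
  fun h0 X f hs hl hq hX => h h0 Ω X f hs hl hq hX

/-- **The closed `Ω`-transfer follows from the crux's `p`-slice** (pure logic; the transcendence-degree
hypothesis is idle in this direction). [folklore] -/
theorem omegaTransfer_of_primeModelTransferAt {p : ℕ} (h : PrimeModelTransferAt p) : OmegaTransfer p :=
  fun Ω _ _ _ _ => omegaTransferAt_of_primeModelTransferAt h Ω

end Summit.ResolutionOfSingularities.ResolutionOfSingularities.Theorems.CampaignW82

end
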